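import Literature.NumberTheory.Weil1964.AdelicMetaplecticDirectSum
import Literature.NumberTheory.Weil1964.AdelicMetaplecticFiniteImplementer
import Literature.NumberTheory.Weil1964.ArchTwoFactorCovariance
import Literature.NumberTheory.Automorphic.AdelicSchwartzBruhatDirectSumPure
import HarnessLib

/-!
# Tensor/direct-sum compatibility of the adelic metaplectic operators (two-factor Schur lemma)

Origin: `pub-hodgecm` MODEL-CONSTRUCTION sub-cell, node W2-⊗ (⊗S)-𝔸 (iii) + final adelic assembly (the statement of
record of BINDER-TRIAGE §30.3). KERNEL MATHEMATICS ONLY: no `def … : Prop` records, no `axiom`, no proof hole. A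
REPRODUCTION of a published theorem (Literature side).

Setting: a number field `F`, index types `ι₁, ι₂`, invertible Gram matrices `T_j ∈ GL_{ι_j}(𝔸_F)`, the orthogonal direct
sum `W₁ ⊕ W₂` with Gram matrix `T = fromBlocks T₁ 0 0 T₂`, the global Schrödinger representations
`ρ_j = adelicSchrodinger F ι_j T_j`, `ρ = adelicSchrodinger F (ι₁ ⊕ ι₂) T` on `𝒮(𝔸_F^{ι_j})`, `𝒮(𝔸_F^{ι₁ ⊕ ι₂})`
[MoeglinVignerasWaldspurger1987, Chap. 2 I.4 Exemple (1)], Weil's groups `adelicMp F ι T = Mp^ψ(W) = {(g, M) : M ρ(h) M⁻¹ = ρ(g h)}`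
[Weil1964, Chap. III n° 37 pp. 188–189; MoeglinVignerasWaldspurger1987, Chap. 2 II.1 (A)] with their continuous parts
`adelicMpCont`, the see-saw embedding `(g₁, g₂) ↦ g₁ ⊕ g₂ = UnitaryGroup.spSum T₁ T₂ (g₁, g₂)` [Kudla1984, §1] and the
separate-variables product `Φ₁ ⊠ Φ₂ = tensorToSum F ι₁ ι₂ Φ₁ Φ₂ ∈ 𝒮(𝔸_F^{ι₁ ⊕ ι₂})`.

**Main theorem** (`exists_ne_zero_smul_tensorToSum_of_fst_eq_spSum`): if `(g_j, M_j) ∈ Mp^ψ(W_j)` are continuous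
(`j = 1, 2`) and `(g₁ ⊕ g₂, M) ∈ Mp^ψ(W₁ ⊕ W₂)` is continuous, then there is ONE scalar `c ≠ 0` with
`M (Φ₁ ⊠ Φ₂) = c • (M₁ Φ₁ ⊠ M₂ Φ₂)` for all `Φ₁, Φ₂` — the functoriality
`𝐫(s₁ ⊕ s₂) = 𝐫(s₁) ⊗ 𝐫(s₂)` (up to the central `c`) of Weil's metaplectic representation for orthogonal direct sums
[Weil1964, Chap. III n° 37–38 pp. 188–190 (the local and adelic `𝐫`; n° 38: restriction to a direct-sum decomposition);
MoeglinVignerasWaldspurger1987, Chap. 2 II.1 (A) (with the uniqueness of `M` up to `ℂˣ`); Kudla1984, §1 (see-saw pairs)].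

Assembly (all inputs are landed tree theorems, consumed by name):
* tensor stripping `M = A ⊗ M_f` on `𝒮(𝔸^ι) = 𝓢((F ⊗ ℝ)^ι) ⊗ 𝒮((𝔸_F^∞)^ι)` for continuous metaplectic operators
  (`AdelicMetaplecticTensorStripping.exists_continuousLinearEquiv_of_mem_adelicMpCont`), fed with the finite
  implementers `M_{f,j}` of `AdelicMetaplecticFiniteImplementer.exists_finImplementer` and, for the sum, with the
  by-construction finite implementer `M_{f,1} ⊠ M_{f,2}` of `AdelicMetaplecticDirectSum.finSumAut_implements_of_fst_eq_spSum`
  — so the finite scalar is `c_f = 1`;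
* the archimedean two-factor theorem `A (Φ₁ ⊠ Φ₂) = c_∞ • (A₁ Φ₁ ⊠ A₂ Φ₂)` (`ArchTwoFactorCovariance.arch_two_factor`,
  Folland coordinates and the projective Schur lemma for `𝓢`);
* the pure-tensor packaging `c = c_∞ c_f` (`AdelicSchwartzBruhatDirectSumPure.exists_ne_zero_smul_tensorToSum`).

## References
* [Weil1964] A. Weil, *Sur certains groupes d'opérateurs unitaires*, Acta Math. 111 (1964) 143–211, Chap. III
  n° 37–38 pp. 188–190.
* [MoeglinVignerasWaldspurger1987] C. Mœglin, M.-F. Vignéras, J.-L. Waldspurger, *Correspondances de Howe sur un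
  corps p-adique*, LNM 1291 (1987), Chap. 2 I.4 Exemple (1), II.1 (A).
* [Kudla1984] S. Kudla, *Seesaw dual reductive pairs*, in: Automorphic forms of several variables (Katata 1983),
  Progr. Math. 46 (1984) 244–268, §1.
-/

set_option autoImplicit false

noncomputable section

open scoped Matrix SchwartzMap TensorProduct Classical

open NumberField NumberField.mixedEmbedding IsDedekindDomain

namespace Literature.NumberTheory.Weil1964

open Literature.NumberTheory.Automorphic Literature.RepresentationTheory.HeisenbergGroup

variable {F : Type} [Field F] [NumberField F]

/-! ### §1 One-factor preliminaries -/

section OneFactor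

variable {ι : Type} [Fintype ι]

/-- The indicator `𝟙_{𝒪̂^ι}` of the unit box is a NONZERO finite test vector (its value at `0` is `1`). [folklore] -/
theorem indicatorSB_top_ne_zero :
    indicatorSB F ι (piLevelIdeal F ι ⊤) (isOpen_piLevelIdeal F ⊤) (isCompact_piLevelIdeal F ι ⊤) ≠ 0 := by
  intro h
  have hmem : (0 : ι → FiniteAdeleRing (𝓞 F) F) ∈
      ((piLevelIdeal F ι ⊤ : AddSubgroup (ι → FiniteAdeleRing (𝓞 F) F)) : Set (ι → FiniteAdeleRing (𝓞 F) F)) :=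
    zero_mem _
  have h0 := congrArg (fun f : FinSB F ι => (f : (ι → FiniteAdeleRing (𝓞 F) F) → ℂ) 0) h
  rw [coe_indicatorSB, Set.indicator_of_mem hmem] at h0
  exact one_ne_zero h0

/-- A tensor-product operator `M = A ⊗ B` evaluated on a pure tensor: `M (Φ ⊗ f) = A Φ ⊗ B f`. [folklore] -/
theorem apply_piSchwartzBruhatEquiv_tmul_of_eq_adelicTensorEnd
    {M : piSchwartzBruhat F ι ≃ₗ[ℂ] piSchwartzBruhat F ι}
    {A : 𝓢((ι → mixedSpace F), ℂ) →ₗ[ℂ] 𝓢((ι → mixedSpace F), ℂ)} {B : FinSB F ι →ₗ[ℂ] FinSB F ι}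
    (hM : (M : piSchwartzBruhat F ι →ₗ[ℂ] piSchwartzBruhat F ι) = adelicTensorEnd A B)
    (Φ : 𝓢((ι → mixedSpace F), ℂ)) (f : FinSB F ι) :
    M (piSchwartzBruhatEquiv F ι (Φ ⊗ₜ f)) = piSchwartzBruhatEquiv F ι (A Φ ⊗ₜ B f) := by
  have h := LinearMap.congr_fun hM (piSchwartzBruhatEquiv F ι (Φ ⊗ₜ f))
  rw [adelicTensorEnd_apply_tmul] at h
  exact h

end OneFactor

/-! ### §2 The two-factor Schur lemma for the adelic metaplectic operators -/

section TwoFactor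

variable {ι₁ ι₂ : Type} [Fintype ι₁] [Fintype ι₂] [DecidableEq ι₁] [DecidableEq ι₂]
variable {T₁ : Matrix ι₁ ι₁ (AdeleRing (𝓞 F) F)} {T₂ : Matrix ι₂ ι₂ (AdeleRing (𝓞 F) F)}

/-- **Two-factor Schur lemma, with given finite implementers.** Let `T_j` be invertible, `(g_j, M_j) ∈ Mp^ψ(W_j)`
continuous with finite implementers `M_{f,j}` (`1 ⊗ M_{f,j}` implements `g_j` on the finite Heisenberg elements), and
`(G, M) ∈ Mp^ψ(W₁ ⊕ W₂)` continuous with `G = g₁ ⊕ g₂`. Then `M (Φ₁ ⊠ Φ₂) = c • (M₁ Φ₁ ⊠ M₂ Φ₂)` for ONE scalar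
`c ≠ 0` and all `Φ₁ ∈ 𝒮(𝔸_F^{ι₁})`, `Φ₂ ∈ 𝒮(𝔸_F^{ι₂})`.
[cite: Weil1964, Chap. III n° 37–38 pp. 188–190; MoeglinVignerasWaldspurger1987, Chap. 2 II.1 (A); Kudla1984, §1] -/
theorem exists_ne_zero_smul_tensorToSum_of_finImplementers (hT₁ : IsUnit T₁) (hT₂ : IsUnit T₂)
    (p₁ : adelicMp F ι₁ T₁) (hp₁ : p₁ ∈ adelicMpCont F ι₁ T₁)
    (p₂ : adelicMp F ι₂ T₂) (hp₂ : p₂ ∈ adelicMpCont F ι₂ T₂)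
    (p : adelicMp F (ι₁ ⊕ ι₂) (Matrix.fromBlocks T₁ 0 0 T₂))
    (hp : p ∈ adelicMpCont F (ι₁ ⊕ ι₂) (Matrix.fromBlocks T₁ 0 0 T₂))
    (hG : (p : symplecticGroup (polar (adelicForm F (ι₁ ⊕ ι₂) (Matrix.fromBlocks T₁ 0 0 T₂))) ×
        (piSchwartzBruhat F (ι₁ ⊕ ι₂) ≃ₗ[ℂ] piSchwartzBruhat F (ι₁ ⊕ ι₂))).1 =
      UnitaryGroup.spSum T₁ T₂
        ((p₁ : symplecticGroup (polar (adelicForm F ι₁ T₁)) × (piSchwartzBruhat F ι₁ ≃ₗ[ℂ] piSchwartzBruhat F ι₁)).1,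
         (p₂ : symplecticGroup (polar (adelicForm F ι₂ T₂)) × (piSchwartzBruhat F ι₂ ≃ₗ[ℂ] piSchwartzBruhat F ι₂)).1))
    (A₁f : FinSB F ι₁ ≃ₗ[ℂ] FinSB F ι₁)
    (hA₁f : ∀ h ∈ finHeisenberg T₁, ∀ Φ : piSchwartzBruhat F ι₁,
      adelicTensorEnd LinearMap.id (A₁f : FinSB F ι₁ →ₗ[ℂ] FinSB F ι₁) (adelicSchrodinger F ι₁ T₁ h Φ) =
        adelicSchrodinger F ι₁ T₁
          ((ofSymplectic (polar (adelicForm F ι₁ T₁))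
            (p₁ : symplecticGroup (polar (adelicForm F ι₁ T₁)) × (piSchwartzBruhat F ι₁ ≃ₗ[ℂ] piSchwartzBruhat F ι₁)).1).act
              h)
          (adelicTensorEnd LinearMap.id (A₁f : FinSB F ι₁ →ₗ[ℂ] FinSB F ι₁) Φ))
    (A₂f : FinSB F ι₂ ≃ₗ[ℂ] FinSB F ι₂)
    (hA₂f : ∀ h ∈ finHeisenberg T₂, ∀ Φ : piSchwartzBruhat F ι₂,
      adelicTensorEnd LinearMap.id (A₂f : FinSB F ι₂ →ₗ[ℂ] FinSB F ι₂) (adelicSchrodinger F ι₂ T₂ h Φ) =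
        adelicSchrodinger F ι₂ T₂
          ((ofSymplectic (polar (adelicForm F ι₂ T₂))
            (p₂ : symplecticGroup (polar (adelicForm F ι₂ T₂)) × (piSchwartzBruhat F ι₂ ≃ₗ[ℂ] piSchwartzBruhat F ι₂)).1).act
              h)
          (adelicTensorEnd LinearMap.id (A₂f : FinSB F ι₂ →ₗ[ℂ] FinSB F ι₂) Φ)) :
    ∃ c : ℂ, c ≠ 0 ∧ ∀ (Φ₁ : piSchwartzBruhat F ι₁) (Φ₂ : piSchwartzBruhat F ι₂),
      (p : symplecticGroup (polar (adelicForm F (ι₁ ⊕ ι₂) (Matrix.fromBlocks T₁ 0 0 T₂))) ×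
          (piSchwartzBruhat F (ι₁ ⊕ ι₂) ≃ₗ[ℂ] piSchwartzBruhat F (ι₁ ⊕ ι₂))).2 (tensorToSum F ι₁ ι₂ Φ₁ Φ₂) =
        c • tensorToSum F ι₁ ι₂
          ((p₁ : symplecticGroup (polar (adelicForm F ι₁ T₁)) × (piSchwartzBruhat F ι₁ ≃ₗ[ℂ] piSchwartzBruhat F ι₁)).2 Φ₁)
          ((p₂ : symplecticGroup (polar (adelicForm F ι₂ T₂)) × (piSchwartzBruhat F ι₂ ≃ₗ[ℂ] piSchwartzBruhat F ι₂)).2 Φ₂) := by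
  -- `y ↦ T y` is onto for the blocks and for the block sum
  have hS₁ := mulVec_surjective_of_isUnit hT₁
  have hS₂ := mulVec_surjective_of_isUnit hT₂
  have hS := mulVec_fromBlocks_surjective hS₁ hS₂
  -- the finite implementer `M_{f,1} ⊠ M_{f,2}` of the sum, BY CONSTRUCTION (finite scalar `c_f = 1`)
  have hMf := finSumAut_implements_of_fst_eq_spSum hA₁f hA₂f p hG
  -- tensor stripping of the three continuous metaplectic operators
  obtain ⟨A, hA, -⟩ := exists_continuousLinearEquiv_of_mem_adelicMpCont hS p hp (finSumAut A₁f A₂f) hMf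
  obtain ⟨A₁, hA₁, -⟩ := exists_continuousLinearEquiv_of_mem_adelicMpCont hS₁ p₁ hp₁ A₁f hA₁f
  obtain ⟨A₂, hA₂, -⟩ := exists_continuousLinearEquiv_of_mem_adelicMpCont hS₂ p₂ hp₂ A₂f hA₂f
  -- the archimedean scalar `c_∞`: Folland coordinates + projective Schur lemma for `𝓢`
  have hinf := arch_two_factor (NumberField.mixedEmbedding.stdBasis F) T₁ T₂
    (isUnit_archMat_of_isUnit (T := T₁) hT₁) (isUnit_archMat_of_isUnit (T := T₂) hT₂)
    (p : symplecticGroup (polar (adelicForm F (ι₁ ⊕ ι₂) (Matrix.fromBlocks T₁ 0 0 T₂))) ×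
      (piSchwartzBruhat F (ι₁ ⊕ ι₂) ≃ₗ[ℂ] piSchwartzBruhat F (ι₁ ⊕ ι₂))).1
    (p₁ : symplecticGroup (polar (adelicForm F ι₁ T₁)) × (piSchwartzBruhat F ι₁ ≃ₗ[ℂ] piSchwartzBruhat F ι₁)).1
    (p₂ : symplecticGroup (polar (adelicForm F ι₂ T₂)) × (piSchwartzBruhat F ι₂ ≃ₗ[ℂ] piSchwartzBruhat F ι₂)).1
    (fun x₁ y₁ x₂ y₂ => by
      rw [hG]
      exact spSum_apply_elim _ _ x₁ y₁ x₂ y₂)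
    (p : symplecticGroup (polar (adelicForm F (ι₁ ⊕ ι₂) (Matrix.fromBlocks T₁ 0 0 T₂))) ×
      (piSchwartzBruhat F (ι₁ ⊕ ι₂) ≃ₗ[ℂ] piSchwartzBruhat F (ι₁ ⊕ ι₂))).2
    ((mem_MpPsi _ _).1 p.2) A (finSumAut A₁f A₂f : FinSB F (ι₁ ⊕ ι₂) →ₗ[ℂ] FinSB F (ι₁ ⊕ ι₂))
    (fun Φ f => apply_piSchwartzBruhatEquiv_tmul_of_eq_adelicTensorEnd hA Φ f)
    (f₀ := indicatorSB F (ι₁ ⊕ ι₂) (piLevelIdeal F (ι₁ ⊕ ι₂) ⊤) (isOpen_piLevelIdeal F ⊤)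
      (isCompact_piLevelIdeal F (ι₁ ⊕ ι₂) ⊤))
    (by
      simp only [LinearEquiv.coe_coe]
      exact (finSumAut A₁f A₂f).map_ne_zero_iff.2 indicatorSB_top_ne_zero)
    (p₁ : symplecticGroup (polar (adelicForm F ι₁ T₁)) × (piSchwartzBruhat F ι₁ ≃ₗ[ℂ] piSchwartzBruhat F ι₁)).2
    ((mem_MpPsi _ _).1 p₁.2) A₁ (A₁f : FinSB F ι₁ →ₗ[ℂ] FinSB F ι₁)
    (fun Φ f => apply_piSchwartzBruhatEquiv_tmul_of_eq_adelicTensorEnd hA₁ Φ f)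
    (f₁ := indicatorSB F ι₁ (piLevelIdeal F ι₁ ⊤) (isOpen_piLevelIdeal F ⊤) (isCompact_piLevelIdeal F ι₁ ⊤))
    (by
      simp only [LinearEquiv.coe_coe]
      exact A₁f.map_ne_zero_iff.2 indicatorSB_top_ne_zero)
    (p₂ : symplecticGroup (polar (adelicForm F ι₂ T₂)) × (piSchwartzBruhat F ι₂ ≃ₗ[ℂ] piSchwartzBruhat F ι₂)).2
    ((mem_MpPsi _ _).1 p₂.2) A₂ (A₂f : FinSB F ι₂ →ₗ[ℂ] FinSB F ι₂)
    (fun Φ f => apply_piSchwartzBruhatEquiv_tmul_of_eq_adelicTensorEnd hA₂ Φ f)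
    (f₂ := indicatorSB F ι₂ (piLevelIdeal F ι₂ ⊤) (isOpen_piLevelIdeal F ⊤) (isCompact_piLevelIdeal F ι₂ ⊤))
    (by
      simp only [LinearEquiv.coe_coe]
      exact A₂f.map_ne_zero_iff.2 indicatorSB_top_ne_zero)
  -- the finite scalar `c_f = 1`
  have hfin : ∃ cfin : ℂ, cfin ≠ 0 ∧ ∀ (f₁ : FinSB F ι₁) (f₂ : FinSB F ι₂),
      (finSumAut A₁f A₂f : FinSB F (ι₁ ⊕ ι₂) →ₗ[ℂ] FinSB F (ι₁ ⊕ ι₂)) (finSumEquiv F ι₁ ι₂ (f₁ ⊗ₜ f₂)) =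
        cfin • finSumEquiv F ι₁ ι₂ ((A₁f : FinSB F ι₁ →ₗ[ℂ] FinSB F ι₁) f₁ ⊗ₜ (A₂f : FinSB F ι₂ →ₗ[ℂ] FinSB F ι₂) f₂) :=
    ⟨1, one_ne_zero, fun f₁ f₂ => by
      simp only [one_smul, LinearEquiv.coe_coe]
      exact finSumAut_apply_tmul A₁f A₂f f₁ f₂⟩
  -- assembly on pure tensors: `c = c_∞ · c_f`
  obtain ⟨c, hc, h⟩ := exists_ne_zero_smul_tensorToSum hA hA₁ hA₂ hinf hfin
  exact ⟨c, hc, fun Φ₁ Φ₂ => h Φ₁ Φ₂⟩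

/-- **Two-factor Schur lemma for the adelic metaplectic operators** (statement of record of node W2-⊗ (⊗S)-𝔸 (iii)).
Let `T₁, T₂` be invertible, `(g_j, M_j) ∈ Mp^ψ(W_j)` continuous (`j = 1, 2`) and `(G, M) ∈ Mp^ψ(W₁ ⊕ W₂)` continuous with
`G = g₁ ⊕ g₂`. Then there is ONE scalar `c ≠ 0` with `M (Φ₁ ⊠ Φ₂) = c • (M₁ Φ₁ ⊠ M₂ Φ₂)` for all `Φ₁ ∈ 𝒮(𝔸_F^{ι₁})`,
`Φ₂ ∈ 𝒮(𝔸_F^{ι₂})` — `𝐫(s₁ ⊕ s₂) = 𝐫(s₁) ⊗ 𝐫(s₂)` up to `ℂˣ`.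
[cite: Weil1964, Chap. III n° 37–38 pp. 188–190; MoeglinVignerasWaldspurger1987, Chap. 2 II.1 (A); Kudla1984, §1] -/
theorem exists_ne_zero_smul_tensorToSum_of_fst_eq_spSum (hT₁ : IsUnit T₁) (hT₂ : IsUnit T₂)
    (p₁ : adelicMp F ι₁ T₁) (hp₁ : p₁ ∈ adelicMpCont F ι₁ T₁)
    (p₂ : adelicMp F ι₂ T₂) (hp₂ : p₂ ∈ adelicMpCont F ι₂ T₂)
    (p : adelicMp F (ι₁ ⊕ ι₂) (Matrix.fromBlocks T₁ 0 0 T₂))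
    (hp : p ∈ adelicMpCont F (ι₁ ⊕ ι₂) (Matrix.fromBlocks T₁ 0 0 T₂))
    (hG : (p : symplecticGroup (polar (adelicForm F (ι₁ ⊕ ι₂) (Matrix.fromBlocks T₁ 0 0 T₂))) ×
        (piSchwartzBruhat F (ι₁ ⊕ ι₂) ≃ₗ[ℂ] piSchwartzBruhat F (ι₁ ⊕ ι₂))).1 =
      UnitaryGroup.spSum T₁ T₂
        ((p₁ : symplecticGroup (polar (adelicForm F ι₁ T₁)) × (piSchwartzBruhat F ι₁ ≃ₗ[ℂ] piSchwartzBruhat F ι₁)).1,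
         (p₂ : symplecticGroup (polar (adelicForm F ι₂ T₂)) × (piSchwartzBruhat F ι₂ ≃ₗ[ℂ] piSchwartzBruhat F ι₂)).1)) :
    ∃ c : ℂ, c ≠ 0 ∧ ∀ (Φ₁ : piSchwartzBruhat F ι₁) (Φ₂ : piSchwartzBruhat F ι₂),
      (p : symplecticGroup (polar (adelicForm F (ι₁ ⊕ ι₂) (Matrix.fromBlocks T₁ 0 0 T₂))) ×
          (piSchwartzBruhat F (ι₁ ⊕ ι₂) ≃ₗ[ℂ] piSchwartzBruhat F (ι₁ ⊕ ι₂))).2 (tensorToSum F ι₁ ι₂ Φ₁ Φ₂) =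
        c • tensorToSum F ι₁ ι₂
          ((p₁ : symplecticGroup (polar (adelicForm F ι₁ T₁)) × (piSchwartzBruhat F ι₁ ≃ₗ[ℂ] piSchwartzBruhat F ι₁)).2 Φ₁)
          ((p₂ : symplecticGroup (polar (adelicForm F ι₂ T₂)) × (piSchwartzBruhat F ι₂ ≃ₗ[ℂ] piSchwartzBruhat F ι₂)).2 Φ₂) := by
  obtain ⟨A₁f, hA₁f⟩ := exists_finImplementer (mulVec_surjective_of_isUnit hT₁) p₁
  obtain ⟨A₂f, hA₂f⟩ := exists_finImplementer (mulVec_surjective_of_isUnit hT₂) p₂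
  exact exists_ne_zero_smul_tensorToSum_of_finImplementers hT₁ hT₂ p₁ hp₁ p₂ hp₂ p hp hG A₁f hA₁f A₂f hA₂f

end TwoFactor

end Literature.NumberTheory.Weil1964

end
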